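import Mathlib
import Summits.NavierStokesRegularity.NavierStokesRegularity.Theorems.FilamentSkeletonRssClause13ModelPieceBandPrelim
import Summits.NavierStokesRegularity.NavierStokesRegularity.Theorems.FilamentSkeletonRssClause13CutoffCommutatorRefined

/-!
# Clause 13-J/13-R, brick n3 LAYER C (FAR PIECE, operator side): `‖𝓛Y_H‖₂ ≤ (1+‖k‖₁)‖𝓛Y‖₂ + Λ‖P_T‖₂ + (Λ₂(‖t²k′‖₁+‖t k‖₁) + (L₁+L₂)‖t k‖₁)‖Y‖₂`

Route `FilamentSkeletonRss`, ∃-side clause 13 (`Clause13RNearStraightL` stmt-NavierStokesRegularity-23612; typing-agnostic); design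
`filament-plan/DESIGN-28296-model-gluing-g16.md` §2 ("refined commutator: this is what makes the H piece close") and v2 addendum §C (C5/C7).
For the far piece `Y_H = Y − k∗Y` the first-order commutator bound `Λ(‖t k′‖₁+‖k‖₁)‖Y‖₂` (p693953) is NOT small; the refined commutator
(p697060) writes `[k∗, w]∂Y = −w′·P_T + Rem` with the TRANSITION PIECE `P_T = (t k′ + k)∗Y` (profile `−zχ′(z)`, supported where the near profile
varies, i.e. inside a window with a large gain) and `‖Rem‖₂ ≤ Λ₂(‖t²k′‖₁ + ‖t k‖₁)‖Y‖₂`.  Hence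
`l2_modelOperator_far_le`: `‖𝓛Y_H‖₂ ≤ (1+‖k‖₁)‖𝓛Y‖₂ + Λ‖P_T‖₂ + (Λ₂(‖t²k′‖₁+‖t k‖₁) + (L₁+L₂)‖t k‖₁)‖Y‖₂`, the `‖𝓛Y_H‖₂` input of
`model_piece_far_estimate` (p704476).
Lane ns-filament-19175-p1 g16; `--supports stmt-NavierStokesRegularity-23612 --as helper`.
HONEST FRAMING: bookkeeping about an explicit 1-D model operator attached to a HYPOTHETICAL filament skeleton on the NEGATIVE side of a MODEL route;
nothing here bears on Navier–Stokes regularity or blow-up.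
-/

noncomputable section

open MeasureTheory Real Complex Filter Set
open scoped ComplexConjugate Topology

namespace Summit.NavierStokesRegularity.NavierStokesRegularity.Theorems.MatchedKernel
set_option linter.dupNamespace false

/-- **OPERATOR ON THE FAR PIECE.**  `q > 0`; `k` real `C¹`, bounded, `k, t k, t k′, t²k′ ∈ L¹`; `Y ∈ C¹_c`; `w ∈ C²` with `|w′| ≤ Λ`, `|w″| ≤ Λ₂`;
`β_i` continuous, `‖β_i‖ ≤ b_i`, `‖β_i(y) − β_i(x)‖ ≤ L_i|y−x|`.  With `Y_H = Y − k∗Y`, `P_T(x) = ∫((x−y)k′(x−y) + k(x−y))Y(y)dy`,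
`N(f) = (∫‖f‖²)^{1/2}`:  `N(𝓛Y_H) ≤ (1 + ‖k‖₁)N(𝓛Y) + Λ·N(P_T) + (Λ₂(‖t²k′‖₁ + ‖t k‖₁) + (L₁+L₂)‖t k‖₁)·N(Y)`. [folklore] -/
theorem l2_modelOperator_far_le {q G : ℝ} (hq : 0 < q) {k k' : ℝ → ℝ} (hk : ∀ t, HasDerivAt k (k' t) t) (hk'c : Continuous k')
    (hki : Integrable k) (hk1 : Integrable fun t => t * k t) (hk'1 : Integrable fun t => t * k' t)
    (hk'2 : Integrable fun t => t ^ 2 * k' t) {Mk : ℝ} (hkM : ∀ t, |k t| ≤ Mk)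
    {Y : ℝ → ℂ} (hY : ContDiff ℝ 1 Y) (hYs : HasCompactSupport Y)
    {w : ℝ → ℝ} (hw : Differentiable ℝ w) (hw2 : Differentiable ℝ (deriv w)) {Λ Λ₂ : ℝ} (hΛ : ∀ t, |deriv w t| ≤ Λ)
    (hΛ₂ : ∀ t, |deriv (deriv w) t| ≤ Λ₂)
    {β₁ β₂ : ℝ → ℂ} (hβ₁c : Continuous β₁) (hβ₂c : Continuous β₂) {b₁ b₂ L₁ L₂ : ℝ}
    (hb₁ : ∀ τ, ‖β₁ τ‖ ≤ b₁) (hb₂ : ∀ τ, ‖β₂ τ‖ ≤ b₂) (hL₁ : ∀ x y, ‖β₁ y - β₁ x‖ ≤ L₁ * |y - x|)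
    (hL₂ : ∀ x y, ‖β₂ y - β₂ x‖ ≤ L₂ * |y - x|) :
    (∫ x : ℝ, ‖I * (G : ℂ) * ((2 / q : ℂ) * (Y x - ∫ y : ℝ, ((k (x - y) : ℝ) : ℂ) * Y y)
          - ∫ σ : ℝ, ((((2 * q - (x - σ) ^ 2) * (((x - σ) ^ 2 + q) ^ (5 / 2 : ℝ))⁻¹ : ℝ)) : ℂ) * (Y σ - ∫ y : ℝ, ((k (σ - y) : ℝ) : ℂ) * Y y))
        - ((w x : ℝ) : ℂ) * (deriv Y x - ∫ y : ℝ, ((k (x - y) : ℝ) : ℂ) * deriv Y y) + β₁ x * (Y x - ∫ y : ℝ, ((k (x - y) : ℝ) : ℂ) * Y y) + β₂ x * conj (Y x - ∫ y : ℝ, ((k (x - y) : ℝ) : ℂ) * Y y)‖ ^ 2) ^ (1 / 2 : ℝ)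
      ≤ (1 + (∫ t, |k t|)) * (∫ y : ℝ, ‖I * (G : ℂ) * ((2 / q : ℂ) * Y y
          - ∫ σ : ℝ, ((((2 * q - (y - σ) ^ 2) * (((y - σ) ^ 2 + q) ^ (5 / 2 : ℝ))⁻¹ : ℝ)) : ℂ) * Y σ)
        - ((w y : ℝ) : ℂ) * deriv Y y + β₁ y * Y y + β₂ y * conj (Y y)‖ ^ 2) ^ (1 / 2 : ℝ)
        + Λ * (∫ x : ℝ, ‖∫ y : ℝ, (((x - y) * k' (x - y) + k (x - y) : ℝ) : ℂ) * Y y‖ ^ 2) ^ (1 / 2 : ℝ)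
        + (Λ₂ * ((∫ t, t ^ 2 * |k' t|) + (∫ t, |t| * |k t|)) + (L₁ + L₂) * (∫ t, |t| * |k t|)) * (∫ y : ℝ, ‖Y y‖ ^ 2) ^ (1 / 2 : ℝ) := by
  have hkc : Continuous k := continuous_iff_continuousAt.2 fun t => (hk t).continuousAt
  have hYc := hY.continuous
  have hY'c : Continuous (deriv Y) := hY.continuous_deriv le_rfl
  have hYd : ∀ y, HasDerivAt Y (deriv Y y) y := fun y => (hY.differentiable one_ne_zero y).hasDerivAt
  have hYi : Integrable Y := hYc.integrable_of_hasCompactSupport hYs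
  have hΛ0 : 0 ≤ Λ := (abs_nonneg _).trans (hΛ 0)
  have hΛ20 : 0 ≤ Λ₂ := (abs_nonneg _).trans (hΛ₂ 0)
  have hP1 : Integrable fun x : ℝ => ∫ y : ℝ, ((k (x - y) : ℝ) : ℂ) * Y y := integrable_piece hki hYc hYs
  -- the functions
  set LY : ℝ → ℂ := fun y => I * (G : ℂ) * ((2 / q : ℂ) * Y y
          - ∫ σ : ℝ, ((((2 * q - (y - σ) ^ 2) * (((y - σ) ^ 2 + q) ^ (5 / 2 : ℝ))⁻¹ : ℝ)) : ℂ) * Y σ)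
        - ((w y : ℝ) : ℂ) * deriv Y y + β₁ y * Y y + β₂ y * conj (Y y) with hLY
  set A : ℝ → ℂ := fun x => ∫ y : ℝ, ((k (x - y) : ℝ) : ℂ) * LY y with hA
  set T : ℝ → ℂ := fun x => ∫ y, ((k (x - y) * (w y - w x) : ℝ) : ℂ) * deriv Y y with hT
  set M1 : ℝ → ℂ := fun x => ∫ y, ((k (x - y) : ℝ) : ℂ) * (β₁ y - β₁ x) * Y y with hM1
  set M2 : ℝ → ℂ := fun x => ∫ y, ((k (x - y) : ℝ) : ℂ) * (β₂ y - β₂ x) * conj (Y y) with hM2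
  set PT : ℝ → ℂ := fun x => ∫ y : ℝ, (((x - y) * k' (x - y) + k (x - y) : ℝ) : ℂ) * Y y with hPT
  set Rm : ℝ → ℂ := fun x => ∫ y : ℝ, ((k' (x - y) * (w y - w x - deriv w x * (y - x)) - k (x - y) * (deriv w y - deriv w x) : ℝ) : ℂ) * Y y with hRm
  -- the piece operator and the refined commutator
  have hP : ∀ x : ℝ, I * (G : ℂ) * ((2 / q : ℂ) * (∫ y : ℝ, ((k (x - y) : ℝ) : ℂ) * Y y)
          - ∫ σ : ℝ, ((((2 * q - (x - σ) ^ 2) * (((x - σ) ^ 2 + q) ^ (5 / 2 : ℝ))⁻¹ : ℝ)) : ℂ) * ∫ y : ℝ, ((k (σ - y) : ℝ) : ℂ) * Y y)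
        - ((w x : ℝ) : ℂ) * (∫ y : ℝ, ((k (x - y) : ℝ) : ℂ) * deriv Y y) + β₁ x * (∫ y : ℝ, ((k (x - y) : ℝ) : ℂ) * Y y) + β₂ x * conj (∫ y : ℝ, ((k (x - y) : ℝ) : ℂ) * Y y)
      = ((A x + T x) - M1 x) - M2 x := by
    intro x
    have h := pieceOperator_eq (G := G) hq hkc hki hkM hY hYs hw.continuous hβ₁c.aestronglyMeasurable hβ₂c.aestronglyMeasurable hb₁ hb₂ x
    rw [h]
  have hTeq : ∀ x : ℝ, T x = -((deriv w x : ℝ) : ℂ) * PT x + Rm x :=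
    fun x => transportCommutator_eq_main_add_remainder hk hk'c hw hw2 hΛ hYd hY'c hYs x
  -- linearity: `𝓛Y_H = 𝓛Y − 𝓛P`
  have hsplit : ∀ x : ℝ, I * (G : ℂ) * ((2 / q : ℂ) * (Y x - ∫ y : ℝ, ((k (x - y) : ℝ) : ℂ) * Y y)
          - ∫ σ : ℝ, ((((2 * q - (x - σ) ^ 2) * (((x - σ) ^ 2 + q) ^ (5 / 2 : ℝ))⁻¹ : ℝ)) : ℂ) * (Y σ - ∫ y : ℝ, ((k (σ - y) : ℝ) : ℂ) * Y y))
        - ((w x : ℝ) : ℂ) * (deriv Y x - ∫ y : ℝ, ((k (x - y) : ℝ) : ℂ) * deriv Y y) + β₁ x * (Y x - ∫ y : ℝ, ((k (x - y) : ℝ) : ℂ) * Y y) + β₂ x * conj (Y x - ∫ y : ℝ, ((k (x - y) : ℝ) : ℂ) * Y y)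
      = LY x - (I * (G : ℂ) * ((2 / q : ℂ) * (∫ y : ℝ, ((k (x - y) : ℝ) : ℂ) * Y y)
          - ∫ σ : ℝ, ((((2 * q - (x - σ) ^ 2) * (((x - σ) ^ 2 + q) ^ (5 / 2 : ℝ))⁻¹ : ℝ)) : ℂ) * ∫ y : ℝ, ((k (σ - y) : ℝ) : ℂ) * Y y)
        - ((w x : ℝ) : ℂ) * (∫ y : ℝ, ((k (x - y) : ℝ) : ℂ) * deriv Y y) + β₁ x * (∫ y : ℝ, ((k (x - y) : ℝ) : ℂ) * Y y) + β₂ x * conj (∫ y : ℝ, ((k (x - y) : ℝ) : ℂ) * Y y)) := by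
    intro x
    have hIY := integrable_smoothingKernel_mul_of_integrable hq hYi x
    have hIP := integrable_smoothingKernel_mul_of_integrable hq hP1 x
    have hK : ∫ σ : ℝ, ((((2 * q - (x - σ) ^ 2) * (((x - σ) ^ 2 + q) ^ (5 / 2 : ℝ))⁻¹ : ℝ)) : ℂ) * (Y σ - ∫ y : ℝ, ((k (σ - y) : ℝ) : ℂ) * Y y)
        = (∫ σ : ℝ, ((((2 * q - (x - σ) ^ 2) * (((x - σ) ^ 2 + q) ^ (5 / 2 : ℝ))⁻¹ : ℝ)) : ℂ) * Y σ) - ∫ σ : ℝ, ((((2 * q - (x - σ) ^ 2) * (((x - σ) ^ 2 + q) ^ (5 / 2 : ℝ))⁻¹ : ℝ)) : ℂ) * ∫ y : ℝ, ((k (σ - y) : ℝ) : ℂ) * Y y := by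
      rw [← integral_sub hIY hIP]
      refine integral_congr_ae (ae_of_all _ fun σ => ?_); ring
    rw [hK, map_sub]
    simp only [hLY]
    ring
  have hid : ∀ x : ℝ, I * (G : ℂ) * ((2 / q : ℂ) * (Y x - ∫ y : ℝ, ((k (x - y) : ℝ) : ℂ) * Y y)
          - ∫ σ : ℝ, ((((2 * q - (x - σ) ^ 2) * (((x - σ) ^ 2 + q) ^ (5 / 2 : ℝ))⁻¹ : ℝ)) : ℂ) * (Y σ - ∫ y : ℝ, ((k (σ - y) : ℝ) : ℂ) * Y y))
        - ((w x : ℝ) : ℂ) * (deriv Y x - ∫ y : ℝ, ((k (x - y) : ℝ) : ℂ) * deriv Y y) + β₁ x * (Y x - ∫ y : ℝ, ((k (x - y) : ℝ) : ℂ) * Y y) + β₂ x * conj (Y x - ∫ y : ℝ, ((k (x - y) : ℝ) : ℂ) * Y y)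
      = ((((LY x - A x) + ((deriv w x : ℝ) : ℂ) * PT x) - Rm x) + M1 x) + M2 x := by
    intro x
    rw [hsplit x, hP x, hTeq x]
    ring
  simp_rw [hid]
  -- `L²` facts and bounds
  obtain ⟨MLY, hMLY⟩ := exists_bound_modelOperator hq G hY hYs hw.continuous hβ₁c hβ₂c
  have hLY2 : MemLp LY 2 volume := memLp_modelOperator hq G hY hYs hw.continuous hβ₁c hβ₂c hb₁ hb₂
  have hLYc : Continuous LY := continuous_modelOperator hq G hY hYs hw.continuous hβ₁c hβ₂c
  obtain ⟨hA2, hAle⟩ := l2_kernel_mul_le hkc hki hLYc hLY2 hMLY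
  obtain ⟨hPT2, _⟩ := integral_sq_norm_mainConvolution_le hkc hk'c hki hk'1 hYc hYs
  obtain ⟨hRm2, hRmle⟩ := integral_sq_norm_transportCommutatorRemainder_le hk hk'c hk1 hk'2 hw hw2 hΛ₂ hYc hYs
  obtain ⟨hM12, hM1le⟩ := integral_sq_norm_multiplierCommutator_le hkc hk1 hβ₁c hL₁ hYc hYs
  obtain ⟨hM22, hM2le⟩ := integral_sq_norm_multiplierCommutator_le (f := fun y => conj (Y y)) hkc hk1 hβ₂c hL₂
    (Complex.continuous_conj.comp hYc) (hYs.comp_left (g := conj) (map_zero _))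
  have hconj : ∫ y : ℝ, ‖conj (Y y)‖ ^ 2 = ∫ y : ℝ, ‖Y y‖ ^ 2 := by
    refine integral_congr_ae (ae_of_all _ fun y => ?_); simp only [Complex.norm_conj]
  rw [hconj] at hM2le
  have hw'b : ∀ x : ℝ, ‖((deriv w x : ℝ) : ℂ)‖ ≤ Λ := fun x => by rw [Complex.norm_real, Real.norm_eq_abs]; exact hΛ x
  have hw'm : AEStronglyMeasurable (fun x : ℝ => ((deriv w x : ℝ) : ℂ)) volume :=
    (Complex.continuous_ofReal.comp hw2.continuous).aestronglyMeasurable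
  have hWPT2 : MemLp (fun x : ℝ => ((deriv w x : ℝ) : ℂ) * PT x) 2 volume := memLp_boundedMultiplier_mul hw'm hw'b hPT2
  have hWPTle := l2_boundedMultiplier_le (β := fun x : ℝ => ((deriv w x : ℝ) : ℂ)) (f := PT) hw'b hPT2
  have hL1 : 0 ≤ L₁ := by
    have := hL₁ 0 1; rw [sub_zero, abs_one, mul_one] at this; exact (norm_nonneg _).trans this
  have hL2 : 0 ≤ L₂ := by
    have := hL₂ 0 1; rw [sub_zero, abs_one, mul_one] at this; exact (norm_nonneg _).trans this
  have h1 : 0 ≤ ∫ t, |t| * |k t| := integral_nonneg fun t => by positivity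
  have h2 : 0 ≤ ∫ t, t ^ 2 * |k' t| := integral_nonneg fun t => by positivity
  have hRm' := l2_le_of_sq_le (f := Y) (by positivity) hRmle
  have hM1' := l2_le_of_sq_le (f := Y) (mul_nonneg hL1 h1) hM1le
  have hM2' := l2_le_of_sq_le (f := Y) (mul_nonneg hL2 h1) hM2le
  -- Minkowski five times
  calc (∫ x : ℝ, ‖((((LY x - A x) + ((deriv w x : ℝ) : ℂ) * PT x) - Rm x) + M1 x) + M2 x‖ ^ 2) ^ (1 / 2 : ℝ)
      ≤ (∫ x : ℝ, ‖(((LY x - A x) + ((deriv w x : ℝ) : ℂ) * PT x) - Rm x) + M1 x‖ ^ 2) ^ (1 / 2 : ℝ)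
          + (∫ x : ℝ, ‖M2 x‖ ^ 2) ^ (1 / 2 : ℝ) := l2_add_le ((((hLY2.sub hA2).add hWPT2).sub hRm2).add hM12) hM22
    _ ≤ ((∫ x : ℝ, ‖((LY x - A x) + ((deriv w x : ℝ) : ℂ) * PT x) - Rm x‖ ^ 2) ^ (1 / 2 : ℝ)
          + (∫ x : ℝ, ‖M1 x‖ ^ 2) ^ (1 / 2 : ℝ)) + (∫ x : ℝ, ‖M2 x‖ ^ 2) ^ (1 / 2 : ℝ) := by
        gcongr; exact l2_add_le (((hLY2.sub hA2).add hWPT2).sub hRm2) hM12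
    _ ≤ (((∫ x : ℝ, ‖(LY x - A x) + ((deriv w x : ℝ) : ℂ) * PT x‖ ^ 2) ^ (1 / 2 : ℝ)
          + (∫ x : ℝ, ‖Rm x‖ ^ 2) ^ (1 / 2 : ℝ)) + (∫ x : ℝ, ‖M1 x‖ ^ 2) ^ (1 / 2 : ℝ)) + (∫ x : ℝ, ‖M2 x‖ ^ 2) ^ (1 / 2 : ℝ) := by
        gcongr; exact l2_sub_le ((hLY2.sub hA2).add hWPT2) hRm2
    _ ≤ ((((∫ x : ℝ, ‖LY x - A x‖ ^ 2) ^ (1 / 2 : ℝ) + (∫ x : ℝ, ‖((deriv w x : ℝ) : ℂ) * PT x‖ ^ 2) ^ (1 / 2 : ℝ))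
          + (∫ x : ℝ, ‖Rm x‖ ^ 2) ^ (1 / 2 : ℝ)) + (∫ x : ℝ, ‖M1 x‖ ^ 2) ^ (1 / 2 : ℝ)) + (∫ x : ℝ, ‖M2 x‖ ^ 2) ^ (1 / 2 : ℝ) := by
        gcongr; exact l2_add_le (hLY2.sub hA2) hWPT2
    _ ≤ (((((∫ x : ℝ, ‖LY x‖ ^ 2) ^ (1 / 2 : ℝ) + (∫ x : ℝ, ‖A x‖ ^ 2) ^ (1 / 2 : ℝ))
          + (∫ x : ℝ, ‖((deriv w x : ℝ) : ℂ) * PT x‖ ^ 2) ^ (1 / 2 : ℝ))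
          + (∫ x : ℝ, ‖Rm x‖ ^ 2) ^ (1 / 2 : ℝ)) + (∫ x : ℝ, ‖M1 x‖ ^ 2) ^ (1 / 2 : ℝ)) + (∫ x : ℝ, ‖M2 x‖ ^ 2) ^ (1 / 2 : ℝ) := by
        gcongr; exact l2_sub_le hLY2 hA2
    _ ≤ (((((∫ x : ℝ, ‖LY x‖ ^ 2) ^ (1 / 2 : ℝ) + (∫ t, |k t|) * (∫ y : ℝ, ‖LY y‖ ^ 2) ^ (1 / 2 : ℝ))
          + Λ * (∫ x : ℝ, ‖PT x‖ ^ 2) ^ (1 / 2 : ℝ))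
          + Λ₂ * ((∫ t, t ^ 2 * |k' t|) + (∫ t, |t| * |k t|)) * (∫ y : ℝ, ‖Y y‖ ^ 2) ^ (1 / 2 : ℝ))
          + L₁ * (∫ t, |t| * |k t|) * (∫ y : ℝ, ‖Y y‖ ^ 2) ^ (1 / 2 : ℝ)) + L₂ * (∫ t, |t| * |k t|) * (∫ y : ℝ, ‖Y y‖ ^ 2) ^ (1 / 2 : ℝ) := by
        gcongr
    _ = _ := by ring

end Summit.NavierStokesRegularity.NavierStokesRegularity.Theorems.MatchedKernel

end
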